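/-
Origin: written from primary sources — S. Gelbart, J. Rogawski, Invent. Math. 105 (1991) §3.1 Remark p. 457 (two
splittings differ by a character); C. Mœglin, M.-F. Vignéras, J.-L. Waldspurger (1987) Chap. 2 II.1 (B) (the centre of
`Mp_ψ` is the scalars); R. Howe (1979) §3 / S. Kudla (1984) §1 (see-saw). Adapted: no. This file is the JUNCTION of
`AdelicMetaplecticScalarTwist` (twist of a section by a character, `ω(s ⊗ η) = η • ω(s)`) with
`AdelicMetaplecticSeesawSum` (the see-saw character along a decomposition `e : κ ≃ κ₁ ⊕ κ₂`): how the see-saw character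
changes when the three homomorphisms are twisted. Kernel only; no records.
-/
import Literature.NumberTheory.Weil1964.AdelicMetaplecticSeesawSum
import Literature.NumberTheory.Weil1964.AdelicMetaplecticScalarTwist
import HarnessLib

-- buildfix G11b-3 recipe (LEDGER B13-1/B13-3): elaborate sequentially so the trailing `attribute [implicit_reducible]`
-- block (reducibilityCoreExt is keyed to the async environment branch) is in force at `.olean` export.
set_option Elab.async false

/-!
# The see-saw character under scalar twists of the three splittings

For `S : P →* Mp_ψ(W_T)ᶜᵒⁿᵗ`, `s_j : P →* Mp_ψ(W_{T_j})ᶜᵒⁿᵗ` see-saw compatible through `e` (`hS`) and characters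
`η, η₁, η₂ : P →* ℂˣ`:

* `hS_twist` — the twisted triple `S ⊗ η, s₁ ⊗ η₁, s₂ ⊗ η₂` is again see-saw compatible (`π` does not see the twist);
* `omega_sumSeesawSplitting_twist_apply` — `ω((S ⊗ η)^{⊕}(p)) Ψ = η(p) • ω(S^{⊕}(p)) Ψ` in block-sum coordinates;
* `omega_twist_tensorToSum`, **`coe_mpSeesawCharSum_twist` / `mpSeesawCharSum_twist`** —
  `χ[S ⊗ η; s₁ ⊗ η₁, s₂ ⊗ η₂](p) = η(p) · χ[S; s₁, s₂](p) · (η₁(p) η₂(p))⁻¹`: the see-saw character is multiplied by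
  `η / (η₁ η₂)`.

Provenance / use (Hodge-CM model-construction cell, node W2-Kn «K-norm», rows `gen12`/`real34`): the K-type
normalisation replaces the compatible splitting `s` of record by `s ⊗ (η∘det)` (unitary-1's `wmInputCM` v2) and the small
splittings by their own twists; this lemma is the bookkeeping of the see-saw / factor characters of
`UnitaryDualPairSeesawCharacter` / `…SchemeSmall` under that replacement (choose `η_j` so that the archimedean components
of the new `charSmall_j` are trivial). Nothing here chooses the characters.
-/

set_option autoImplicit false

noncomputable section

open NumberField
open scoped Matrix

namespace Literature.NumberTheory.Weil1964

open Literature.RepresentationTheory.HeisenbergGroup Literature.NumberTheory.Automorphic IsDedekindDomain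
open Literature.NumberTheory.Automorphic.UnitaryGroup (spReindex spSum)

section Twist

variable {F : Type} [Field F] [NumberField F] {κ κ₁ κ₂ : Type} [Fintype κ] [DecidableEq κ] [Fintype κ₁]
  [DecidableEq κ₁] [Fintype κ₂] [DecidableEq κ₂] (e : κ ≃ κ₁ ⊕ κ₂)
  {T : Matrix κ κ (AdeleRing (𝓞 F) F)} {T₁ : Matrix κ₁ κ₁ (AdeleRing (𝓞 F) F)} {T₂ : Matrix κ₂ κ₂ (AdeleRing (𝓞 F) F)}
  (hT : Matrix.reindex e e T = Matrix.fromBlocks T₁ 0 0 T₂)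
  {P : Type*} [Group P]
  (S : P →* adelicMpCont F κ T) (s₁ : P →* adelicMpCont F κ₁ T₁) (s₂ : P →* adelicMpCont F κ₂ T₂)
  (η η₁ η₂ : P →* ℂˣ)
  (hS : ∀ p : P,
    (spReindex e T (adelicMpCont.proj F κ T (S p))).1 =
      (spSum T₁ T₂ (adelicMpCont.proj F κ₁ T₁ (s₁ p), adelicMpCont.proj F κ₂ T₂ (s₂ p))).1)
  (hT₁ : IsUnit T₁) (hT₂ : IsUnit T₂)

include hS in
/-- **the twisted triple is see-saw compatible** (`π ∘ (s ⊗ η) = π ∘ s`). [cite: MoeglinVignerasWaldspurger1987, Chap. 2 II.1 (B)] -/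
theorem hS_twist : ∀ p : P,
    (spReindex e T (adelicMpCont.proj F κ T (adelicMpCont.twist F κ T S η p))).1 =
      (spSum T₁ T₂ (adelicMpCont.proj F κ₁ T₁ (adelicMpCont.twist F κ₁ T₁ s₁ η₁ p),
        adelicMpCont.proj F κ₂ T₂ (adelicMpCont.twist F κ₂ T₂ s₂ η₂ p))).1 :=
  fun p =>
    ((congrArg (fun x => (spReindex e T x).1) (adelicMpCont.proj_twist S η p)).trans (hS p)).trans
      (congrArg₂ (fun x y => (spSum T₁ T₂ (x, y)).1) (adelicMpCont.proj_twist s₁ η₁ p).symm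
        (adelicMpCont.proj_twist s₂ η₂ p).symm)

/-- **in block-sum coordinates the twist of `S` is still a scalar**:
`ω((S ⊗ η)^{⊕}(p)) Ψ = η(p) • ω(S^{⊕}(p)) Ψ`, `S^{⊕} := sumSeesawSplitting e hT S`. [folklore] -/
theorem omega_sumSeesawSplitting_twist_apply (p : P) (Ψ : piSchwartzBruhat F (κ₁ ⊕ κ₂)) :
    adelicMpCont.omega F (κ₁ ⊕ κ₂) (Matrix.fromBlocks T₁ 0 0 T₂)
        (sumSeesawSplitting e hT (adelicMpCont.twist F κ T S η) p) Ψ =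
      ((η p : ℂˣ) : ℂ) •
        adelicMpCont.omega F (κ₁ ⊕ κ₂) (Matrix.fromBlocks T₁ 0 0 T₂) (sumSeesawSplitting e hT S p) Ψ :=
  ((omega_sumSeesawSplitting_apply e hT (adelicMpCont.twist F κ T S η) p Ψ).trans
    ((congrArg (piSBReindex F e) (adelicMpCont.omega_twist S η p ((piSBReindex F e).symm Ψ))).trans
      (LinearEquiv.map_smul (piSBReindex F e) _ _))).trans
    (congrArg (fun Φ => ((η p : ℂˣ) : ℂ) • Φ) (omega_sumSeesawSplitting_apply e hT S p Ψ).symm)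

omit [DecidableEq κ₁] [DecidableEq κ₂] in
/-- `(a • Φ₁) ⊠ (b • Φ₂) = (a b) • (Φ₁ ⊠ Φ₂)`. [folklore] -/
theorem tensorToSum_smul_smul (a b : ℂ) (Φ₁ : piSchwartzBruhat F κ₁) (Φ₂ : piSchwartzBruhat F κ₂) :
    tensorToSum F κ₁ κ₂ (a • Φ₁) (b • Φ₂) = (a * b) • tensorToSum F κ₁ κ₂ Φ₁ Φ₂ := by
  rw [LinearMap.map_smul₂, map_smul, smul_smul]

/-- the per-element identity behind `mpSeesawCharSum_twist`: with `χ = χ[S; s₁, s₂](p)`,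
`ω((S ⊗ η)^{⊕} p) (Φ₁ ⊠ Φ₂) = (η(p) χ (η₁(p) η₂(p))⁻¹) • (ω((s₁ ⊗ η₁) p) Φ₁ ⊠ ω((s₂ ⊗ η₂) p) Φ₂)`. [folklore] -/
theorem omega_twist_tensorToSum (p : P) (Φ₁ : piSchwartzBruhat F κ₁) (Φ₂ : piSchwartzBruhat F κ₂) :
    adelicMpCont.omega F (κ₁ ⊕ κ₂) (Matrix.fromBlocks T₁ 0 0 T₂)
        (sumSeesawSplitting e hT (adelicMpCont.twist F κ T S η) p) (tensorToSum F κ₁ κ₂ Φ₁ Φ₂) =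
      (((η p : ℂˣ) : ℂ) * (mpSeesawCharSum e hT S s₁ s₂ hS hT₁ hT₂ p : ℂ) *
          (((η₁ p : ℂˣ) : ℂ) * ((η₂ p : ℂˣ) : ℂ))⁻¹) •
        tensorToSum F κ₁ κ₂ (adelicMpCont.omega F κ₁ T₁ (adelicMpCont.twist F κ₁ T₁ s₁ η₁ p) Φ₁)
          (adelicMpCont.omega F κ₂ T₂ (adelicMpCont.twist F κ₂ T₂ s₂ η₂ p) Φ₂) := by
  have h0 : ((η₁ p : ℂˣ) : ℂ) * ((η₂ p : ℂˣ) : ℂ) ≠ 0 := mul_ne_zero (Units.ne_zero _) (Units.ne_zero _)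
  have step :
      adelicMpCont.omega F (κ₁ ⊕ κ₂) (Matrix.fromBlocks T₁ 0 0 T₂)
          (sumSeesawSplitting e hT (adelicMpCont.twist F κ T S η) p) (tensorToSum F κ₁ κ₂ Φ₁ Φ₂) =
        (((η p : ℂˣ) : ℂ) * (mpSeesawCharSum e hT S s₁ s₂ hS hT₁ hT₂ p : ℂ)) •
          tensorToSum F κ₁ κ₂ (adelicMpCont.omega F κ₁ T₁ (s₁ p) Φ₁) (adelicMpCont.omega F κ₂ T₂ (s₂ p) Φ₂) :=
    ((omega_sumSeesawSplitting_twist_apply e hT S η p (tensorToSum F κ₁ κ₂ Φ₁ Φ₂)).trans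
      (congrArg (fun Φ => ((η p : ℂˣ) : ℂ) • Φ)
        (mpSeesawChar_spec (sumSeesawSplitting e hT S) s₁ s₂ (proj_sumSeesawSplitting e hT S s₁ s₂ hS) hT₁ hT₂ p
          Φ₁ Φ₂))).trans
      (smul_smul _ _ _)
  have rhs :
      tensorToSum F κ₁ κ₂ (adelicMpCont.omega F κ₁ T₁ (adelicMpCont.twist F κ₁ T₁ s₁ η₁ p) Φ₁)
          (adelicMpCont.omega F κ₂ T₂ (adelicMpCont.twist F κ₂ T₂ s₂ η₂ p) Φ₂) =
        (((η₁ p : ℂˣ) : ℂ) * ((η₂ p : ℂˣ) : ℂ)) •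
          tensorToSum F κ₁ κ₂ (adelicMpCont.omega F κ₁ T₁ (s₁ p) Φ₁) (adelicMpCont.omega F κ₂ T₂ (s₂ p) Φ₂) :=
    tensorToSum_smul_smul _ _ _ _
  have hsc : ((η p : ℂˣ) : ℂ) * (mpSeesawCharSum e hT S s₁ s₂ hS hT₁ hT₂ p : ℂ) =
      ((η p : ℂˣ) : ℂ) * (mpSeesawCharSum e hT S s₁ s₂ hS hT₁ hT₂ p : ℂ) *
          (((η₁ p : ℂˣ) : ℂ) * ((η₂ p : ℂˣ) : ℂ))⁻¹ * (((η₁ p : ℂˣ) : ℂ) * ((η₂ p : ℂˣ) : ℂ)) := by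
    rw [mul_assoc _ _⁻¹, inv_mul_cancel₀ h0, mul_one]
  exact step.trans ((congrArg (fun a : ℂ => a • tensorToSum F κ₁ κ₂ (adelicMpCont.omega F κ₁ T₁ (s₁ p) Φ₁)
      (adelicMpCont.omega F κ₂ T₂ (s₂ p) Φ₂)) hsc).trans
    ((smul_smul _ _ _).symm.trans (congrArg (fun Φ => (((η p : ℂˣ) : ℂ) *
        (mpSeesawCharSum e hT S s₁ s₂ hS hT₁ hT₂ p : ℂ) * (((η₁ p : ℂˣ) : ℂ) * ((η₂ p : ℂˣ) : ℂ))⁻¹) • Φ) rhs.symm)))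

/-- **THE SEE-SAW CHARACTER UNDER SCALAR TWISTS**: `χ[S ⊗ η; s₁ ⊗ η₁, s₂ ⊗ η₂](p) = η(p) · χ[S; s₁, s₂](p) · (η₁(p) η₂(p))⁻¹`
(as complex numbers). (cf. S. Gelbart–J. Rogawski (1991) §3.1 Remark p. 457) [folklore] -/
theorem coe_mpSeesawCharSum_twist (p : P) :
    (mpSeesawCharSum e hT (adelicMpCont.twist F κ T S η) (adelicMpCont.twist F κ₁ T₁ s₁ η₁)
        (adelicMpCont.twist F κ₂ T₂ s₂ η₂) (hS_twist e S s₁ s₂ η η₁ η₂ hS) hT₁ hT₂ p : ℂ) =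
      ((η p : ℂˣ) : ℂ) * (mpSeesawCharSum e hT S s₁ s₂ hS hT₁ hT₂ p : ℂ) *
        (((η₁ p : ℂˣ) : ℂ) * ((η₂ p : ℂˣ) : ℂ))⁻¹ :=
  coe_mpSeesawChar_eq (sumSeesawSplitting e hT (adelicMpCont.twist F κ T S η)) (adelicMpCont.twist F κ₁ T₁ s₁ η₁)
    (adelicMpCont.twist F κ₂ T₂ s₂ η₂)
    (proj_sumSeesawSplitting e hT (adelicMpCont.twist F κ T S η) (adelicMpCont.twist F κ₁ T₁ s₁ η₁)
      (adelicMpCont.twist F κ₂ T₂ s₂ η₂) (hS_twist e S s₁ s₂ η η₁ η₂ hS))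
    hT₁ hT₂ (fun Φ₁ Φ₂ => omega_twist_tensorToSum e hT S s₁ s₂ η η₁ η₂ hS hT₁ hT₂ p Φ₁ Φ₂)

/-- **unit-valued form**: `χ[S ⊗ η; s₁ ⊗ η₁, s₂ ⊗ η₂](p) = η(p) · χ[S; s₁, s₂](p) · (η₁(p) η₂(p))⁻¹` in `ℂˣ`. [folklore] -/
theorem mpSeesawCharSum_twist (p : P) :
    mpSeesawCharSum e hT (adelicMpCont.twist F κ T S η) (adelicMpCont.twist F κ₁ T₁ s₁ η₁)
        (adelicMpCont.twist F κ₂ T₂ s₂ η₂) (hS_twist e S s₁ s₂ η η₁ η₂ hS) hT₁ hT₂ p =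
      η p * mpSeesawCharSum e hT S s₁ s₂ hS hT₁ hT₂ p * (η₁ p * η₂ p)⁻¹ :=
  Units.ext (by
    rw [Units.val_mul, Units.val_mul, Units.val_inv_eq_inv_val, Units.val_mul]
    exact coe_mpSeesawCharSum_twist e hT S s₁ s₂ η η₁ η₂ hS hT₁ hT₂ p)

end Twist

/-! ### Build-lane note (ops-buildfix G11b-3 recipe, LEDGER B13-1, 2026-08-21)
`lean -o` (the hub build lane, never `lean`/the gate check) runs Lean 4.32's library-suggestion indexers
(`Lean.LibrarySuggestions.SymbolFrequency` / `SineQuaNon`, from their `exportEntriesFn`) over the statement of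
every local theorem that is not a denied premise; on this family's statements (very large dependent binder
telescopes through the theta-kernel / dual-pair data) that fold runs for tens of minutes to hours and the build
lane kills the job (incident G11b-3, run/shared/lean/ops/buildfix/G11b-3-DOSSIER.md). `isDeniedPremise` skips
`[implicit_reducible]` constants before any fold, and a reducibility status on a *theorem* is inert (Meta never
unfolds `thmInfo`; the kernel ignores the attribute), so the public theorems of this file are tagged
`[implicit_reducible]` purely to keep them out of that index. Only other effect: they are not offered by
`+suggestions` premise selectors. No statement or proof is changed; superseded if the operator lands a
deny-list form (`HarnessLib.PremiseIndex`). -/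
set_option allowUnsafeReducibility true in
attribute [implicit_reducible]
  hS_twist omega_sumSeesawSplitting_twist_apply tensorToSum_smul_smul omega_twist_tensorToSum
  coe_mpSeesawCharSum_twist mpSeesawCharSum_twist

end Literature.NumberTheory.Weil1964

end
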